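import Summits.HodgeConjecture.HodgeConjecture.Theorems.TropicalWeilObstructionTropicalWeilVanishingCalibrationTwo
import Summits.HodgeConjecture.HodgeConjecture.Theorems.TropicalWeilObstructionTropicalWeilVanishingBoundaryCalibrated
import HarnessLib

/-!
# Route `TropicalWeilObstruction` (Kontsevich's tropical test — NEGATION SINK, exploration, no summit claim):
# the `n = 2` calibration seed is CALIBRATED — the `n = 2` analogue of the boundary sub-question K1_∂ is false

Negation-sink bookkeeping of the cell `pub-hodge-tropical` (seat tropical-2 gen 8, refereeing tropical-1 gen 8's boundary series).
Tropical-1 gen 8 isolated the boundary sub-question **K1_∂** of the open crux K1 (`Boundary.TropicalWeilBoundaryVanishing`,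
p349747: on a very general tropical Weil EIGHTFOLD every CALIBRATED effective tropical `4`-cycle — `‖W(Z)‖ = μ(Z)`, equivalently all
cells' complex determinants `η_σ` on one real line — has `W(Z) = 0`) and PREDICTED (cell INBOX 2026-08-23T02:50Z) that the `n = 2`
calibration seed of this cell — the tropicalised van Geemen exceptional cycle, a tree object since p356781 (`CalibTwo.seed`: `240`
cells on `ℝ⁴/Qℤ⁴`, `Q = ½·QZ`, class `4θ₂ − 2Re w`, ON the boundary `4(q₁²+q₂²) = q₀²` of the `n = 2` calibration cone) — must have
EVERY complex determinant purely imaginary. This file confirms the prediction in the kernel and draws the consequence: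

* `CalibTwo.reEta_Fz_eq_zero` — `Re η_σ = 0` for all `240` cells (`decide`);
* `CalibTwo.norm_weilFunctional_seed_eq_mass`, `CalibTwo.weilFunctional_seed_eq_neg_mass` — the seed is CALIBRATED, of phase `−1`:
  `W(seed) = −μ(seed)` (`Boundary.norm_weilFunctional_eq_mass_of_collinear`, p348404, any `n`);
* `linearlyRealisable_of_sections_on_spanning_family`, `exists_weilGeneric_framePreserving_of_unobstructedSeed` (any `n`, any base
  period) — p351568's transport of an unobstructed `W ≠ 0` seed to a very general period, now recording that the transported cycle has
  the SAME frames (every frame property of the seed's cells persists), hence the same `η_σ`;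
* `CalibTwo.exists_weilGeneric_two_calibrated_weilFunctional_ne_zero` and **`CalibTwo.not_tropicalWeilBoundaryVanishing_two`** — there is
  a very general tropical Weil FOURFOLD period carrying a NON-EMPTY CALIBRATED effective tropical `2`-cycle with `W ≠ 0`; the verbatim
  `n = 2` analogue of K1_∂ is FALSE.

HONEST STATUS. `n = 2` is the dimension in which Weil classes ARE algebraic (Schoen 1988, van Geemen 1996, Markman 2025); this decides
NOTHING about K1 or K1_∂ (`n = 4`, both OPEN) and nothing about the Hodge conjecture in either direction. It records that at `n = 2` the
cone boundary is attained by unobstructed effective types, so that K1_∂ asks precisely whether `n = 4` differs from `n = 2` on the boundary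
(cell file `K1-SCOPE.md` §7). No new definition, no named fact, no sorry.

References: [Zharkov2020TropicalWeil] I. Zharkov, arXiv:2002.02347, §2 (pp. 2–4); [MikhalkinZharkov2014Eigenwave] G. Mikhalkin,
I. Zharkov, LN UMI 15 (2014), Def. 4.2, Prop. 4.3.
-/

set_option linter.dupNamespace false

noncomputable section

open scoped BigOperators Matrix Topology
open Matrix Literature.AlgebraicGeometry.Tropical

namespace Summit.HodgeConjecture.HodgeConjecture.Theorems.TropicalWeilVanishing

/-! ## §1 Transport of an unobstructed seed to a very general period, keeping the frames (any `n`, any base period) -/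

/-- **Finitely many directions suffice** (linear-algebra half of p351568's
`exists_weilGeneric_weilFunctional_ne_zero_of_sections_on_spanning_family`, isolated): if the linearised realisation system of the type
of `Z₀` is solved in each direction of a finite family `E` whose real span contains `Sym_J`, it is solvable in every direction of `Sym_J`
(superpose the sections). [cite: Zharkov2020TropicalWeil, §1–2 (pp. 2–4)] -/
theorem linearlyRealisable_of_sections_on_spanning_family {n : ℕ}
    {Q₀ : Matrix (Fin (2 * n)) (Fin (2 * n)) ℝ} (Z₀ : TropicalTorusCycle (2 * n) n Q₀)
    {ι : Type*} [Fintype ι] (E : ι → Matrix (Fin (2 * n)) (Fin (2 * n)) ℝ)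
    (hspan : ∀ D : Matrix (Fin (2 * n)) (Fin (2 * n)) ℝ, D.IsSymm → D * weilJ n = weilJ n * D →
      D ∈ Submodule.span ℝ (Set.range E))
    (v : ι → Fin Z₀.numCells → Fin (n + 1) → Fin (2 * n) → ℝ)
    (T : ι → Fin Z₀.numCells → Matrix (Fin n) (Fin n) ℝ)
    (r : ι → Fin Z₀.numFacetClasses → Fin n → Fin (2 * n) → ℝ)
    (hv : ∀ (i : ι) (σ : Fin Z₀.numCells) (j : Fin n) (a : Fin (2 * n)),
      v i σ j.succ a - v i σ 0 a = ∑ m, ((Z₀.cell σ).frame a m : ℝ) * T i σ m j)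
    (hr : ∀ (i : ι) (σ : Fin Z₀.numCells) (i' : Fin (n + 1)) (j : Fin n) (a : Fin (2 * n)),
      v i σ (i'.succAbove (Z₀.facetPerm σ i' j)) a =
        r i (Z₀.facetClass σ i') j a + ∑ b, E i a b * (Z₀.facetShift σ i' b : ℝ)) :
    ∀ D : Matrix (Fin (2 * n)) (Fin (2 * n)) ℝ, D.IsSymm → D * weilJ n = weilJ n * D →
      ∃ (v : Fin Z₀.numCells → Fin (n + 1) → Fin (2 * n) → ℝ)
        (T : Fin Z₀.numCells → Matrix (Fin n) (Fin n) ℝ)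
        (r : Fin Z₀.numFacetClasses → Fin n → Fin (2 * n) → ℝ),
        (∀ (σ : Fin Z₀.numCells) (j : Fin n) (a : Fin (2 * n)),
            v σ j.succ a - v σ 0 a = ∑ m, ((Z₀.cell σ).frame a m : ℝ) * T σ m j) ∧
        (∀ (σ : Fin Z₀.numCells) (i : Fin (n + 1)) (j : Fin n) (a : Fin (2 * n)),
            v σ (i.succAbove (Z₀.facetPerm σ i j)) a =
              r (Z₀.facetClass σ i) j a + ∑ b, D a b * (Z₀.facetShift σ i b : ℝ)) := by
  classical
  intro D hDS hDJ
  obtain ⟨c, hc⟩ := (Submodule.mem_span_range_iff_exists_fun ℝ).1 (hspan D hDS hDJ)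
  refine ⟨fun σ j a => ∑ i, c i * v i σ j a, fun σ => ∑ i, c i • T i σ,
    fun f j a => ∑ i, c i * r i f j a, ?_, ?_⟩
  · intro σ j a
    have e : ∀ m, (∑ i, c i • T i σ) m j = ∑ i, c i * T i σ m j := fun m => by
      simp only [Matrix.sum_apply, Matrix.smul_apply, smul_eq_mul]
    simp_rw [e]
    rw [← Finset.sum_sub_distrib]
    simp_rw [← mul_sub, hv, Finset.mul_sum]
    rw [Finset.sum_comm]
    exact Finset.sum_congr rfl fun m _ => Finset.sum_congr rfl fun i _ => by ring
  · intro σ i' j a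
    have eD : ∀ b, D a b = ∑ i, c i * E i a b := fun b => by
      rw [← hc]; simp only [Matrix.sum_apply, Matrix.smul_apply, smul_eq_mul]
    simp_rw [hr, mul_add, Finset.sum_add_distrib, eD, Finset.sum_mul, Finset.mul_sum]
    congr 1
    rw [Finset.sum_comm]
    exact Finset.sum_congr rfl fun b _ => Finset.sum_congr rfl fun i _ => by ring

/-- **Frame-preserving transport of an unobstructed `W ≠ 0` seed** (p351568's
`exists_weilGeneric_weilFunctional_ne_zero_of_unobstructedSeed` with one more clause recorded). If `Q₀` is symmetric and `J`-commuting,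
Weil-generic positive definite `J`-commuting periods accumulate at `Q₀`, and `Z₀` is an effective tropical `n`-cycle on `ℝ²ⁿ/Q₀ℤ²ⁿ` with
`W(Z₀) ≠ 0` whose combinatorial type is linearly realisable in every direction of `Sym_J`, then some Weil-generic positive definite
`J`-commuting `Q` carries an effective tropical `n`-cycle `Z` with `W(Z) ≠ 0`, the same number of cells, and THE SAME FRAMES: every property
of integer `2n × n` frames that holds for all cells of `Z₀` holds for all cells of `Z` (so the complex determinants `η_σ`, collinearity,
flatness, the set of `n`-planes … are those of the seed). [cite: Zharkov2020TropicalWeil, §1–2 (pp. 2–4)]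
[cite: MikhalkinZharkov2014Eigenwave, Def. 4.2 and Prop. 4.3] -/
theorem exists_weilGeneric_framePreserving_of_unobstructedSeed {n : ℕ}
    {Q₀ : Matrix (Fin (2 * n)) (Fin (2 * n)) ℝ} (hQ₀S : Q₀.IsSymm) (hQ₀J : Q₀ * weilJ n = weilJ n * Q₀)
    (hacc : ∀ U : Set (Matrix (Fin (2 * n)) (Fin (2 * n)) ℝ), IsOpen U → Q₀ ∈ U →
      ∃ Q ∈ U, Q.PosDef ∧ Q * weilJ n = weilJ n * Q ∧ IsWeilGeneric n Q)
    (Z₀ : TropicalTorusCycle (2 * n) n Q₀) (hW : weilFunctional Z₀ ≠ 0)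
    (hsec : ∀ D : Matrix (Fin (2 * n)) (Fin (2 * n)) ℝ, D.IsSymm → D * weilJ n = weilJ n * D →
      ∃ (v : Fin Z₀.numCells → Fin (n + 1) → Fin (2 * n) → ℝ)
        (T : Fin Z₀.numCells → Matrix (Fin n) (Fin n) ℝ)
        (r : Fin Z₀.numFacetClasses → Fin n → Fin (2 * n) → ℝ),
        (∀ (σ : Fin Z₀.numCells) (j : Fin n) (a : Fin (2 * n)),
            v σ j.succ a - v σ 0 a = ∑ m, ((Z₀.cell σ).frame a m : ℝ) * T σ m j) ∧
        (∀ (σ : Fin Z₀.numCells) (i : Fin (n + 1)) (j : Fin n) (a : Fin (2 * n)),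
            v σ (i.succAbove (Z₀.facetPerm σ i j)) a =
              r (Z₀.facetClass σ i) j a + ∑ b, D a b * (Z₀.facetShift σ i b : ℝ))) :
    ∃ Q : Matrix (Fin (2 * n)) (Fin (2 * n)) ℝ, Q.PosDef ∧ Q * weilJ n = weilJ n * Q ∧ IsWeilGeneric n Q ∧
      ∃ Z : TropicalTorusCycle (2 * n) n Q, Z.numCells = Z₀.numCells ∧ weilFunctional Z ≠ 0 ∧
        ∀ p : Matrix (Fin (2 * n)) (Fin n) ℤ → Prop, (∀ σ, p (Z₀.cell σ).frame) → ∀ σ, p (Z.cell σ).frame := by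
  obtain ⟨V, T, Rf, hTcont, hT1, hreal⟩ := linearSpread hQ₀S hQ₀J Z₀ hsec
  -- the open set `U ∋ Q₀`: positive edge determinants and non-zero Weil expression
  set U : Set (Matrix (Fin (2 * n)) (Fin (2 * n)) ℝ) := {P | (∀ σ, 0 < (T P σ).det) ∧
    (∑ σ, ((Z₀.cell σ).weight : ℂ) * (((T P σ).det / ((n : ℕ).factorial : ℝ) : ℝ) : ℂ) *
      frameComplexDet n (Z₀.cell σ).frame ^ 2) ≠ 0} with hU
  have hUopen : IsOpen U := by
    have h1 : IsOpen {P : Matrix (Fin (2 * n)) (Fin (2 * n)) ℝ | ∀ σ, 0 < (T P σ).det} := by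
      rw [Set.setOf_forall]
      exact isOpen_iInter_of_finite fun σ => isOpen_lt continuous_const (hTcont σ).matrix_det
    have h2 : IsOpen {P : Matrix (Fin (2 * n)) (Fin (2 * n)) ℝ |
        (∑ σ, ((Z₀.cell σ).weight : ℂ) * (((T P σ).det / ((n : ℕ).factorial : ℝ) : ℝ) : ℂ) *
          frameComplexDet n (Z₀.cell σ).frame ^ 2) ≠ 0} := by
      refine isOpen_ne_fun ?_ continuous_const
      refine continuous_finsetSum _ fun σ _ => ?_
      exact (continuous_const.mul (Complex.continuous_ofReal.comp
        ((hTcont σ).matrix_det.div_const _))).mul continuous_const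
    exact h1.inter h2
  have h0U : Q₀ ∈ U := by
    refine ⟨fun σ => by rw [hT1 σ]; exact (Z₀.cell σ).edgeCoeff_det_pos, ?_⟩
    have e : (∑ σ, ((Z₀.cell σ).weight : ℂ) * (((T Q₀ σ).det / ((n : ℕ).factorial : ℝ) : ℝ) : ℂ) *
        frameComplexDet n (Z₀.cell σ).frame ^ 2) = weilFunctional Z₀ := by
      unfold weilFunctional TropicalCell.latticeVolume
      exact Finset.sum_congr rfl fun σ _ => by rw [hT1 σ]
    rw [e]; exact hW
  -- a Weil-generic positive definite period in `U`, and the realisation over it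
  obtain ⟨Q, hQU, hQ, hQJ, hgen⟩ := hacc U hUopen h0U
  have hQS : Q.IsSymm := by
    have h := hQ.1
    rw [Matrix.IsHermitian, Matrix.conjTranspose_eq_transpose_of_trivial] at h
    exact h
  obtain ⟨hv, hfe⟩ := hreal Q hQS hQJ
  refine ⟨Q, hQ, hQJ, hgen,
    { numCells := Z₀.numCells
      cell := fun σ =>
        { weight := (Z₀.cell σ).weight
          weight_pos := (Z₀.cell σ).weight_pos
          vertex := V Q σ
          frame := (Z₀.cell σ).frame
          edgeCoeff := T Q σ
          vertex_succ_sub := hv σ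
          edgeCoeff_det_pos := hQU.1 σ
          frame_saturated := (Z₀.cell σ).frame_saturated }
      numFacetClasses := Z₀.numFacetClasses
      refFacet := Rf Q
      facetClass := Z₀.facetClass
      facetPerm := Z₀.facetPerm
      facetShift := Z₀.facetShift
      facet_eq := hfe
      balanced := Z₀.balanced }, rfl, hQU.2, fun p hp σ => hp σ⟩

/-- **Corollary: a COLLINEAR unobstructed `W ≠ 0` seed transports to a non-empty CALIBRATED `W ≠ 0` cycle at a very general period**
(any `n`, any base period): collinearity `Re(ζ η_σ) = 0` is a property of the frames, and collinear cycles are calibrated at every period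
(`Boundary.norm_weilFunctional_eq_mass_of_collinear`, p348404). [cite: Zharkov2020TropicalWeil, §1–2 (pp. 2–4)]
[cite: MikhalkinZharkov2014Eigenwave, Def. 4.2 and Prop. 4.3] -/
theorem exists_weilGeneric_calibrated_of_collinear_unobstructedSeed {n : ℕ}
    {Q₀ : Matrix (Fin (2 * n)) (Fin (2 * n)) ℝ} (hQ₀S : Q₀.IsSymm) (hQ₀J : Q₀ * weilJ n = weilJ n * Q₀)
    (hacc : ∀ U : Set (Matrix (Fin (2 * n)) (Fin (2 * n)) ℝ), IsOpen U → Q₀ ∈ U →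
      ∃ Q ∈ U, Q.PosDef ∧ Q * weilJ n = weilJ n * Q ∧ IsWeilGeneric n Q)
    (Z₀ : TropicalTorusCycle (2 * n) n Q₀) (hW : weilFunctional Z₀ ≠ 0)
    (ζ : ℂ) (hζ : ζ ≠ 0) (hcol : ∀ σ, (ζ * frameComplexDet n (Z₀.cell σ).frame).re = 0)
    (hsec : ∀ D : Matrix (Fin (2 * n)) (Fin (2 * n)) ℝ, D.IsSymm → D * weilJ n = weilJ n * D →
      ∃ (v : Fin Z₀.numCells → Fin (n + 1) → Fin (2 * n) → ℝ)
        (T : Fin Z₀.numCells → Matrix (Fin n) (Fin n) ℝ)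
        (r : Fin Z₀.numFacetClasses → Fin n → Fin (2 * n) → ℝ),
        (∀ (σ : Fin Z₀.numCells) (j : Fin n) (a : Fin (2 * n)),
            v σ j.succ a - v σ 0 a = ∑ m, ((Z₀.cell σ).frame a m : ℝ) * T σ m j) ∧
        (∀ (σ : Fin Z₀.numCells) (i : Fin (n + 1)) (j : Fin n) (a : Fin (2 * n)),
            v σ (i.succAbove (Z₀.facetPerm σ i j)) a =
              r (Z₀.facetClass σ i) j a + ∑ b, D a b * (Z₀.facetShift σ i b : ℝ))) :
    ∃ Q : Matrix (Fin (2 * n)) (Fin (2 * n)) ℝ, Q.PosDef ∧ Q * weilJ n = weilJ n * Q ∧ IsWeilGeneric n Q ∧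
      ∃ Z : TropicalTorusCycle (2 * n) n Q, Z.numCells = Z₀.numCells ∧ weilFunctional Z ≠ 0 ∧
        (∀ σ, (ζ * frameComplexDet n (Z.cell σ).frame).re = 0) ∧
        ‖weilFunctional Z‖ = ∑ σ, ((Z.cell σ).weight : ℝ) * (Z.cell σ).latticeVolume *
          ‖frameComplexDet n (Z.cell σ).frame‖ ^ 2 := by
  obtain ⟨Q, hQ, hQJ, hgen, Z, hc, hWZ, hframes⟩ :=
    exists_weilGeneric_framePreserving_of_unobstructedSeed hQ₀S hQ₀J hacc Z₀ hW hsec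
  have hcolZ : ∀ σ, (ζ * frameComplexDet n (Z.cell σ).frame).re = 0 :=
    hframes (fun L => (ζ * frameComplexDet n L).re = 0) hcol
  exact ⟨Q, hQ, hQJ, hgen, Z, hc, hWZ, hcolZ, Boundary.norm_weilFunctional_eq_mass_of_collinear Z ζ hζ hcolZ⟩

/-! ## §2 The `n = 2` seed is collinear (all `η_σ ∈ iℤ`) and calibrated of phase `−1` -/

namespace CalibTwo

/-- **Tropical-1 gen 8's prediction, in the kernel: every one of the `240` complex determinants of the seed is PURELY IMAGINARY.**
[cite: Zharkov2020TropicalWeil, §2 (pp. 2–4)] -/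
theorem reEta_Fz_eq_zero : ∀ σ : Fin N, reEta (Fz σ) = 0 := by
  decide +kernel

/-- The complex determinants of the seed's cells: `η_σ = (Im η_σ)·i`. [cite: Zharkov2020TropicalWeil, §2 (pp. 2–4)] -/
theorem frameComplexDet_seed (σ : Fin N) :
    frameComplexDet 2 (seed.cell σ).frame = ((imEta (Fz σ) : ℤ) : ℂ) * Complex.I := by
  show frameComplexDet 2 (Fz σ) = _
  rw [frameComplexDet_two, reEta_Fz_eq_zero σ]
  simp

/-- The seed is COLLINEAR with `ζ = 1`: `Re η_σ = 0` for every cell. [cite: Zharkov2020TropicalWeil, §2 (pp. 2–4)] -/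
theorem re_frameComplexDet_seed_eq_zero (σ : Fin N) : ((1 : ℂ) * frameComplexDet 2 (seed.cell σ).frame).re = 0 := by
  rw [one_mul, frameComplexDet_seed]
  simp

/-- **The seed is CALIBRATED**: `‖W(seed)‖ = μ(seed) = Σ_σ w_σ a_σ |η_σ|²`. [cite: Zharkov2020TropicalWeil, §2 (pp. 2–4)] -/
theorem norm_weilFunctional_seed_eq_mass :
    ‖weilFunctional seed‖ = ∑ σ, ((seed.cell σ).weight : ℝ) * (seed.cell σ).latticeVolume *
      ‖frameComplexDet 2 (seed.cell σ).frame‖ ^ 2 :=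
  Boundary.norm_weilFunctional_eq_mass_of_collinear seed 1 one_ne_zero re_frameComplexDet_seed_eq_zero

/-- **Phase `−1`**: `W(seed) = −μ(seed)` (every `η_σ² = −(Im η_σ)² ≤ 0`). [cite: Zharkov2020TropicalWeil, §2 (pp. 2–4)] -/
theorem weilFunctional_seed_eq_neg_mass :
    weilFunctional seed = -((∑ σ, ((seed.cell σ).weight : ℝ) * (seed.cell σ).latticeVolume *
      ‖frameComplexDet 2 (seed.cell σ).frame‖ ^ 2 : ℝ) : ℂ) := by
  unfold weilFunctional
  rw [Complex.ofReal_sum, ← Finset.sum_neg_distrib]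
  refine Finset.sum_congr rfl fun σ _ => ?_
  rw [frameComplexDet_seed σ]
  have hI : (((imEta (Fz σ) : ℤ) : ℂ) * Complex.I) ^ 2 = -(((imEta (Fz σ) : ℤ) : ℂ) ^ 2) := by
    rw [mul_pow, Complex.I_sq]; ring
  have hN : ‖((imEta (Fz σ) : ℤ) : ℂ) * Complex.I‖ ^ 2 = ((imEta (Fz σ) : ℤ) : ℝ) ^ 2 := by
    rw [norm_mul, Complex.norm_I, mul_one, Complex.norm_intCast, sq_abs]
  rw [hI, hN]
  push_cast
  ring

/-- `μ(seed) > 0`, so `W(seed) = −μ(seed) < 0` is real and negative (consistent with `2 Re W = reW2 = −32128`). [folklore] -/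
theorem weilFunctional_seed_re_neg : (weilFunctional seed).re < 0 := by
  have h2 := two_mul_weilFunctional_seed_re
  have hneg : (reW2 : ℝ) < 0 := by
    have : reW2 < 0 := by decide
    exact_mod_cast this
  linarith

/-! ## §3 The `n = 2` analogue of K1_∂ is false -/

/-- The linearised realisation system of the seed's type is solvable in EVERY direction of `Sym_J` (`n = 2`): superpose the four integer
sections `SV/ST/SR` (p355713) along `ER 0..3`, which span `Sym_J` (`mem_span_ER`). [cite: Zharkov2020TropicalWeil, §1–2 (pp. 2–4)] -/
theorem seed_linearlyRealisable :
    ∀ D : Matrix (Fin (2 * 2)) (Fin (2 * 2)) ℝ, D.IsSymm → D * weilJ 2 = weilJ 2 * D →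
      ∃ (v : Fin seed.numCells → Fin (2 + 1) → Fin (2 * 2) → ℝ)
        (T : Fin seed.numCells → Matrix (Fin 2) (Fin 2) ℝ)
        (r : Fin seed.numFacetClasses → Fin 2 → Fin (2 * 2) → ℝ),
        (∀ (σ : Fin seed.numCells) (j : Fin 2) (a : Fin (2 * 2)),
            v σ j.succ a - v σ 0 a = ∑ m, ((seed.cell σ).frame a m : ℝ) * T σ m j) ∧
        (∀ (σ : Fin seed.numCells) (i : Fin (2 + 1)) (j : Fin 2) (a : Fin (2 * 2)),
            v σ (i.succAbove (seed.facetPerm σ i j)) a =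
              r (seed.facetClass σ i) j a + ∑ b, D a b * (seed.facetShift σ i b : ℝ)) :=
  linearlyRealisable_of_sections_on_spanning_family seed ER mem_span_ER
    (fun t σ k a => (SV t σ k a : ℝ)) (fun t σ => (ST t σ).map (Int.cast : ℤ → ℝ)) (fun t f j a => (SR t f j a : ℝ))
    (fun t σ j a => by
      have e := congrArg (Int.cast : ℤ → ℝ) (sec_vert t σ j a)
      push_cast at e
      simpa [seed, cellC, Matrix.map_apply] using e)
    (fun t σ i j a => by
      have e := congrArg (Int.cast : ℤ → ℝ) (sec_facet t σ i j a)
      push_cast at e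
      simpa [seed, cellC, ER] using e)

/-- **The `n = 2` calibration, boundary form.** There are a very general tropical Weil FOURFOLD period `Q` (positive definite, `QJ = JQ`,
`IsWeilGeneric 2 Q`) and a NON-EMPTY effective tropical `2`-cycle `Z` on `ℝ⁴/Qℤ⁴` (`240` cells) which is CALIBRATED (`‖W(Z)‖ = μ(Z)`; all
`η_σ` purely imaginary) and has `W(Z) ≠ 0`. [cite: Zharkov2020TropicalWeil, §2 (pp. 2–4)] [cite: MikhalkinZharkov2014Eigenwave, Def. 4.2 and Prop. 4.3] -/
theorem exists_weilGeneric_two_calibrated_weilFunctional_ne_zero :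
    ∃ Q : Matrix (Fin (2 * 2)) (Fin (2 * 2)) ℝ, Q.PosDef ∧ Q * weilJ 2 = weilJ 2 * Q ∧ IsWeilGeneric 2 Q ∧
      ∃ Z : TropicalTorusCycle (2 * 2) 2 Q, Z.numCells = 240 ∧ weilFunctional Z ≠ 0 ∧
        (∀ σ, (frameComplexDet 2 (Z.cell σ).frame).re = 0) ∧
        ‖weilFunctional Z‖ = ∑ σ, ((Z.cell σ).weight : ℝ) * (Z.cell σ).latticeVolume *
          ‖frameComplexDet 2 (Z.cell σ).frame‖ ^ 2 := by
  have hacc := GenericWeilPeriodTwo.exists_weilGeneric_two_mem_of_open QR QR_rat QR_posDef QR_mul_weilJ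
  obtain ⟨Q, hQ, hQJ, hgen, Z, hc, hWZ, hcol, hcal⟩ :=
    exists_weilGeneric_calibrated_of_collinear_unobstructedSeed QR_isSymm QR_mul_weilJ (fun U hU h0 => hacc U hU h0) seed
      weilFunctional_seed_ne_zero 1 one_ne_zero re_frameComplexDet_seed_eq_zero seed_linearlyRealisable
  exact ⟨Q, hQ, hQJ, hgen, Z, hc, hWZ, fun σ => by simpa using hcol σ, hcal⟩

/-- **The verbatim `n = 2` analogue of the boundary sub-question K1_∂ (`Boundary.TropicalWeilBoundaryVanishing`, p349747) is FALSE**: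
it is not the case that every calibrated effective tropical `2`-cycle on a very general tropical Weil fourfold has `W = 0` — as the
classical algebraicity of Weil classes on Weil-type abelian fourfolds demands. Decides nothing about `n = 4` (K1, K1_∂ OPEN) or HC.
[cite: Zharkov2020TropicalWeil, §2 (pp. 2–4)] -/
theorem not_tropicalWeilBoundaryVanishing_two :
    ¬ (∀ Q : Matrix (Fin (2 * 2)) (Fin (2 * 2)) ℝ, Q.PosDef → Q * weilJ 2 = weilJ 2 * Q → IsWeilGeneric 2 Q →
        ∀ Z : TropicalTorusCycle (2 * 2) 2 Q,
          ‖weilFunctional Z‖ = ∑ σ, ((Z.cell σ).weight : ℝ) * (Z.cell σ).latticeVolume *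
              ‖frameComplexDet 2 (Z.cell σ).frame‖ ^ 2 →
          weilFunctional Z = 0) := by
  intro h
  obtain ⟨Q, hQ, hQJ, hgen, Z, -, hW, -, hcal⟩ := exists_weilGeneric_two_calibrated_weilFunctional_ne_zero
  exact hW (h Q hQ hQJ hgen Z hcal)

end CalibTwo

end Summit.HodgeConjecture.HodgeConjecture.Theorems.TropicalWeilVanishing

end
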